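import Literature.NumberTheory.LFunctions.CharacterVonMangoldtSums
import Mathlib.NumberTheory.EulerProduct.DirichletLSeries
import Mathlib.NumberTheory.SumPrimeReciprocals
import Mathlib.Analysis.SpecialFunctions.Log.Deriv
import Mathlib.Analysis.PSeries
import HarnessLib

/-!
# The Euler product of `L(1, χ)` at `s = 1` for a real character:
# `∏_{p ≤ X} (1 − χ(p)/p) → 1/L(1, χ)`

Topic `Literature/NumberTheory/LFunctions`. Everything in this file is PROVED (theorems only).

For a non-principal quadratic Dirichlet character `χ` mod `q` the Euler product of `L(s, χ)`
converges (conditionally) at `s = 1` to `L(1, χ)` (Mertens 1874, Landau). We prove it from the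
absolutely convergent Euler product on `σ > 1` (Mathlib's
`DirichletCharacter.LSeries_eulerProduct_exp_log`) and the Mertens estimate
`∑_{p ≤ x} χ(p) log p/p = O(1)` of `CharacterVonMangoldtSums.lean`:

* `abs_sum_Ioc_mul_le_of_window` — Abel's inequality (real coefficients with bounded window sums
  against a non-negative non-increasing weight);
* `abs_window_sum_rpow_le` — `|∑_{X<p≤Y} χ(p) p^{−σ}| ≤ 2K'/log(X+1)` uniformly in `σ ≥ 1`
  (weights `p^{1−σ}/log p`);
* `log_norm_LFunction_eq_tsum` — `log |L(σ, χ)| = ∑_p −log(1 − χ(p)p^{−σ})` for `σ > 1`;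
* `abs_log_sub_sum_le` — letting `σ → 1+`:
  `|log L(1, χ) − ∑_{p ≤ X} −log(1 − χ(p)/p)| ≤ 2K'/log(X+1) + 4/(X+1)`;
* `tendsto_prod_one_sub_div` — **`∏_{p ≤ X} (1 − χ(p)/p) → L(1, χ)⁻¹`** as `X → ∞`.

This is the input identifying the limit of the Bateman–Horn partial products of
`x² + x + (1 − d)/4` with `ϱ_d · ∏_{p ≤ √|d|}(1 − 1/p)⁻¹(1 − χ(p)/p)⁻¹ / L(1, χ_d)` in the discharge
of Granville–Mollin's Proposition 2 (`Literature.Barriers.Parity.GranvilleMollin2000_prop2`).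

## References

* E. Landau, *Handbuch der Lehre von der Verteilung der Primzahlen* (1909), §109 [folklore].
* H. L. Montgomery, R. C. Vaughan, *Multiplicative Number Theory I*, CUP 2007, §4.3
  [MontgomeryVaughan2007].
-/

noncomputable section

open Complex Filter Topology Finset
open Literature.NumberTheory.LFunctions.DirichletAbel

namespace Literature.NumberTheory.LFunctions.EulerProductOne

/-! ### Abel's inequality for real sequences -/

/-- **Abel's inequality**: if `|∑_{N<k≤n} c(k)| ≤ V` for all `n`, `a(n) ≥ 0` and `a(n+1) ≤ a(n)` for
`n > N`, then `|∑_{N<n≤M} c(n) a(n)| ≤ V a(N+1)`. [cite: MontgomeryVaughan2007, §1.3 Thm. 1.3] -/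
theorem abs_sum_Ioc_mul_le_of_window {c a : ℕ → ℝ} {V : ℝ} {N : ℕ}
    (hS : ∀ n, |∑ k ∈ Ioc N n, c k| ≤ V)
    (ha0 : ∀ n, N < n → 0 ≤ a n) (ha : ∀ n, N < n → a (n + 1) ≤ a n) (M : ℕ) :
    |∑ n ∈ Ioc N M, c n * a n| ≤ V * a (N + 1) := by
  have hV : 0 ≤ V := le_trans (abs_nonneg _) (hS N)
  rcases le_or_gt N M with h | h
  swap
  · rw [Finset.Ioc_eq_empty (by omega), Finset.sum_empty, abs_zero]
    exact mul_nonneg hV (ha0 _ (Nat.lt_succ_self N))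
  have htel : ∑ n ∈ Ioc N M, (a n - a (n + 1)) = a (N + 1) - a (M + 1) := by
    clear ha0 ha hS
    induction M, h using Nat.le_induction with
    | base => simp
    | succ M hNM ih => rw [Finset.sum_Ioc_succ_top hNM, ih]; ring
  rw [ZetaMul.sum_Ioc_mul_eq_abel c a N M]
  have haM : 0 ≤ a (M + 1) := ha0 _ (by omega)
  calc |(∑ n ∈ Ioc N M, c n) * a (M + 1) + ∑ n ∈ Ioc N M, (∑ k ∈ Ioc N n, c k) * (a n - a (n + 1))|
      ≤ |(∑ n ∈ Ioc N M, c n) * a (M + 1)| + ∑ n ∈ Ioc N M, |(∑ k ∈ Ioc N n, c k) * (a n - a (n + 1))| :=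
        (abs_add_le _ _).trans (by gcongr; exact Finset.abs_sum_le_sum_abs _ _)
    _ ≤ V * a (M + 1) + ∑ n ∈ Ioc N M, V * (a n - a (n + 1)) := by
        gcongr with n hn
        · rw [abs_mul, abs_of_nonneg haM]
          exact mul_le_mul_of_nonneg_right (hS M) haM
        · have hn' : N < n := (Finset.mem_Ioc.mp hn).1
          have hd : 0 ≤ a n - a (n + 1) := sub_nonneg.mpr (ha n hn')
          rw [abs_mul, abs_of_nonneg hd]
          exact mul_le_mul_of_nonneg_right (hS n) hd
    _ = V * a (N + 1) := by rw [← Finset.mul_sum, htel]; ring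

/-! ### Window sums `∑_{X < p ≤ Y} χ(p) p^{−σ}` -/

variable {q : ℕ} [NeZero q] (χ : DirichletCharacter ℂ q)

omit [NeZero q] in
/-- Prime sums over a window as `Ioc`-sums with an indicator. [folklore] -/
theorem sum_primesLE_filter_eq_sum_Ioc_ite (f : ℕ → ℝ) (X Y : ℕ) :
    ∑ p ∈ (Nat.primesLE Y).filter (X < ·), f p = ∑ n ∈ Ioc X Y, if n.Prime then f n else 0 := by
  rw [← Finset.sum_filter]
  congr 1
  ext n
  simp only [Finset.mem_filter, Nat.mem_primesLE, Finset.mem_Ioc]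
  tauto

omit [NeZero q] in
/-- The partial sums of `p ↦ χ(p) log p/p` over `(X, n]` are differences of two sums over
`p ≤ ·`, hence bounded by `2K'`. [folklore] -/
theorem abs_sum_Ioc_ite_le {K' : ℝ}
    (hK : ∀ x : ℕ, |∑ p ∈ Nat.primesLE x, (χ (p : ZMod q)).re * Real.log p / p| ≤ K') (X n : ℕ) :
    |∑ k ∈ Ioc X n, (if k.Prime then (χ (k : ZMod q)).re * Real.log k / k else 0)| ≤ 2 * K' := by
  rcases le_or_gt X n with h | h
  · have hsplit : ∑ k ∈ Ioc X n, (if k.Prime then (χ (k : ZMod q)).re * Real.log k / k else 0) =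
        ∑ p ∈ Nat.primesLE n, (χ (p : ZMod q)).re * Real.log p / p -
          ∑ p ∈ Nat.primesLE X, (χ (p : ZMod q)).re * Real.log p / p := by
      rw [← sum_primesLE_filter_eq_sum_Ioc_ite, eq_sub_iff_add_eq, ← Finset.sum_filter_add_sum_filter_not
        (Nat.primesLE n) (X < ·)]
      congr 1
      congr 1
      ext p
      simp only [Finset.mem_filter, Nat.mem_primesLE, not_lt]
      constructor
      · rintro ⟨hpX, hp⟩; exact ⟨⟨hpX.trans h, hp⟩, hpX⟩
      · rintro ⟨⟨-, hp⟩, hpX⟩; exact ⟨hpX, hp⟩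
    rw [hsplit]
    calc _ ≤ |∑ p ∈ Nat.primesLE n, (χ (p : ZMod q)).re * Real.log p / p| +
          |∑ p ∈ Nat.primesLE X, (χ (p : ZMod q)).re * Real.log p / p| := abs_sub _ _
      _ ≤ K' + K' := add_le_add (hK n) (hK X)
      _ = 2 * K' := by ring
  · rw [Finset.Ioc_eq_empty (by omega), Finset.sum_empty, abs_zero]
    linarith [(abs_nonneg _).trans (hK 0)]

omit [NeZero q] in
/-- **Window sums of `χ(p) p^{−σ}` are small, uniformly in `σ ≥ 1`**: if
`|∑_{p ≤ x} χ(p) log p/p| ≤ K'` for all `x`, then for `σ ≥ 1` and `1 ≤ X`,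
`|∑_{X < p ≤ Y} χ(p) p^{−σ}| ≤ 2K'/log(X+1)` (Abel's inequality with the non-increasing weights
`p^{1−σ}/log p`). [cite: MontgomeryVaughan2007, §1.3 Thm. 1.3] -/
theorem abs_window_sum_rpow_le {K' : ℝ}
    (hK : ∀ x : ℕ, |∑ p ∈ Nat.primesLE x, (χ (p : ZMod q)).re * Real.log p / p| ≤ K')
    {σ : ℝ} (hσ : 1 ≤ σ) {X : ℕ} (hX : 1 ≤ X) (Y : ℕ) :
    |∑ p ∈ (Nat.primesLE Y).filter (X < ·), (χ (p : ZMod q)).re * (p : ℝ) ^ (-σ)| ≤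
      2 * K' / Real.log (X + 1) := by
  -- weights `a(n) = n^{1−σ}/log n`
  set a : ℕ → ℝ := fun n => (n : ℝ) ^ (1 - σ) / Real.log n with ha
  set c : ℕ → ℝ := fun k => if k.Prime then (χ (k : ZMod q)).re * Real.log k / k else 0 with hc
  have hprod : ∑ p ∈ (Nat.primesLE Y).filter (X < ·), (χ (p : ZMod q)).re * (p : ℝ) ^ (-σ) =
      ∑ n ∈ Ioc X Y, c n * a n := by
    rw [sum_primesLE_filter_eq_sum_Ioc_ite]
    refine Finset.sum_congr rfl fun n hn => ?_
    simp only [hc, ha]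
    split_ifs with hp
    · have hn2 : (2 : ℝ) ≤ n := by exact_mod_cast hp.two_le
      have hn0 : (0 : ℝ) < n := by linarith
      have hlog : Real.log n ≠ 0 := (Real.log_pos (by linarith)).ne'
      rw [show (1 : ℝ) - σ = -σ + 1 by ring, Real.rpow_add hn0, Real.rpow_one]
      field_simp
    · rw [zero_mul]
  rw [hprod]
  have hX0 : (0 : ℝ) < X := by exact_mod_cast hX
  -- monotonicity of the weights on `n > X ≥ 1`
  have ha0 : ∀ n, X < n → 0 ≤ a n := by
    intro n hn
    have hn1 : (1 : ℝ) < n := by exact_mod_cast lt_of_le_of_lt hX hn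
    exact div_nonneg (Real.rpow_nonneg (by linarith) _) (Real.log_pos hn1).le
  have hanti : ∀ n, X < n → a (n + 1) ≤ a n := by
    intro n hn
    have hn1 : (1 : ℝ) < n := by exact_mod_cast lt_of_le_of_lt hX hn
    have hn0 : (0 : ℝ) < n := by linarith
    have hlogn : 0 < Real.log n := Real.log_pos hn1
    simp only [ha]
    push_cast
    have h1 : ((n : ℝ) + 1) ^ (1 - σ) ≤ (n : ℝ) ^ (1 - σ) :=
      Real.rpow_le_rpow_of_nonpos hn0 (by linarith) (by linarith)
    have h2 : Real.log n ≤ Real.log ((n : ℝ) + 1) := Real.log_le_log hn0 (by linarith)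
    calc ((n : ℝ) + 1) ^ (1 - σ) / Real.log ((n : ℝ) + 1)
        ≤ (n : ℝ) ^ (1 - σ) / Real.log ((n : ℝ) + 1) :=
          div_le_div_of_nonneg_right h1 (hlogn.trans_le h2).le
      _ ≤ (n : ℝ) ^ (1 - σ) / Real.log n :=
          div_le_div_of_nonneg_left (Real.rpow_nonneg hn0.le _) hlogn h2
  have h := abs_sum_Ioc_mul_le_of_window (c := c) (a := a) (abs_sum_Ioc_ite_le χ hK X) ha0 hanti Y
  refine h.trans ?_
  -- `a(X+1) = (X+1)^{1−σ}/log(X+1) ≤ 1/log(X+1)`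
  have hlogX : 0 < Real.log ((X : ℝ) + 1) := Real.log_pos (by linarith)
  have haX : a (X + 1) ≤ 1 / Real.log ((X : ℝ) + 1) := by
    simp only [ha]
    push_cast
    refine div_le_div_of_nonneg_right ?_ hlogX.le
    exact Real.rpow_le_one_of_one_le_of_nonpos (by linarith) (by linarith)
  have hK0 : 0 ≤ 2 * K' := by linarith [(abs_nonneg _).trans (hK 0)]
  calc 2 * K' * a (X + 1) ≤ 2 * K' * (1 / Real.log ((X : ℝ) + 1)) := mul_le_mul_of_nonneg_left haX hK0
    _ = 2 * K' / Real.log (X + 1) := by ring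

/-! ### The Euler factors `−log(1 − χ(p) p^{−σ})` -/

omit [NeZero q] in
/-- The Euler factor of a quadratic character is real: for `p` prime and real `σ ≥ 1`,
`Re(−log(1 − χ(p) p^{−σ})) = −log(1 − Re χ(p) · p^{−σ})`, and `|Re χ(p) p^{−σ}| ≤ 1/2`. [folklore] -/
theorem neg_log_re_eq (hq : χ ^ 2 = 1) {p : ℕ} (hp : p.Prime) {σ : ℝ} (hσ : 1 ≤ σ) :
    (-Complex.log (1 - χ (p : ZMod q) * (p : ℂ) ^ (-(σ : ℂ)))).re =
        -Real.log (1 - (χ (p : ZMod q)).re * (p : ℝ) ^ (-σ)) ∧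
      |(χ (p : ZMod q)).re * (p : ℝ) ^ (-σ)| ≤ 1 / 2 := by
  have hp2 : (2 : ℝ) ≤ p := by exact_mod_cast hp.two_le
  have hp0 : (0 : ℝ) < p := by linarith
  have hrpow : (p : ℝ) ^ (-σ) ≤ 1 / 2 := by
    calc (p : ℝ) ^ (-σ) ≤ (p : ℝ) ^ (-1 : ℝ) := Real.rpow_le_rpow_of_exponent_le (by linarith) (by linarith)
      _ = 1 / p := by rw [Real.rpow_neg_one, one_div]
      _ ≤ 1 / 2 := by gcongr
  have habs : |(χ (p : ZMod q)).re * (p : ℝ) ^ (-σ)| ≤ 1 / 2 := by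
    rw [abs_mul, abs_of_nonneg (Real.rpow_nonneg hp0.le _)]
    calc |(χ (p : ZMod q)).re| * (p : ℝ) ^ (-σ) ≤ 1 * (p : ℝ) ^ (-σ) :=
          mul_le_mul_of_nonneg_right ((Complex.abs_re_le_norm _).trans (χ.norm_le_one _))
            (Real.rpow_nonneg hp0.le _)
      _ ≤ 1 / 2 := by rw [one_mul]; exact hrpow
  refine ⟨?_, habs⟩
  have hreal : (1 : ℂ) - χ (p : ZMod q) * (p : ℂ) ^ (-(σ : ℂ)) =
      (((1 - (χ (p : ZMod q)).re * (p : ℝ) ^ (-σ) : ℝ)) : ℂ) := by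
    obtain ⟨r, hr⟩ : ∃ r : ℝ, χ (p : ZMod q) = r := ⟨_, SiegelZero.apply_eq_ofReal_re χ hq _⟩
    rw [hr, Complex.ofReal_re, Complex.ofReal_sub, Complex.ofReal_one, Complex.ofReal_mul,
      Complex.ofReal_cpow hp0.le, Complex.ofReal_neg, Complex.ofReal_natCast]
  have hpos : 0 < 1 - (χ (p : ZMod q)).re * (p : ℝ) ^ (-σ) := by
    have := (abs_le.mp habs).2; linarith
  rw [hreal, Complex.neg_re, ← Complex.ofReal_log hpos.le, Complex.ofReal_re]

omit [NeZero q] χ in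
/-- Second-order bound: `|−log(1 − u) − u| ≤ 2u²` for `|u| ≤ 1/2` (Mathlib's Taylor estimate for
`log(1 − x)`). [folklore] -/
theorem abs_neg_log_one_sub_sub_le {u : ℝ} (hu : |u| ≤ 1 / 2) :
    |-Real.log (1 - u) - u| ≤ 2 * u ^ 2 := by
  have hlt : |u| < 1 := lt_of_le_of_lt hu (by norm_num)
  have h := Real.abs_log_sub_add_sum_range_le hlt 1
  have hL : ∑ i ∈ Finset.range 1, u ^ (i + 1) / ((i : ℝ) + 1) = u := by simp
  rw [hL] at h
  have h1 : |u| ^ (1 + 1) / (1 - |u|) ≤ 2 * u ^ 2 := by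
    rw [show |u| ^ (1 + 1) = u ^ 2 by rw [show (1 : ℕ) + 1 = 2 from rfl, sq_abs],
      div_le_iff₀ (by linarith [abs_nonneg u])]
    nlinarith [sq_nonneg u, abs_nonneg u]
  calc |-Real.log (1 - u) - u| = |u + Real.log (1 - u)| := by
        rw [← abs_neg]; congr 1; ring
    _ ≤ _ := h.trans h1

/-! ### `log |L(σ, χ)| = ∑_p −log(1 − χ(p)p^{−σ})` for `σ > 1` -/

/-- For `σ > 1`: the terms `−log(1 − Re χ(p) p^{−σ})` are summable over the primes and
`log |L(σ, χ)| = ∑_p −log(1 − Re χ(p) · p^{−σ})` (the logarithm of the absolutely convergent Euler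
product, Mathlib's `DirichletCharacter.LSeries_eulerProduct_exp_log`). [folklore] -/
theorem log_norm_LFunction_eq_tsum (hq : χ ^ 2 = 1) {σ : ℝ} (hσ : 1 < σ) :
    Summable (fun p : Nat.Primes => -Real.log (1 - (χ ((p : ℕ) : ZMod q)).re * ((p : ℕ) : ℝ) ^ (-σ))) ∧
      Real.log ‖χ.LFunction (σ : ℂ)‖ =
        ∑' p : Nat.Primes, -Real.log (1 - (χ ((p : ℕ) : ZMod q)).re * ((p : ℕ) : ℝ) ^ (-σ)) := by
  have hs : 1 < (σ : ℂ).re := by simp [hσ]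
  set w : Nat.Primes → ℂ := fun p => χ ((p : ℕ) : ZMod q) * ((p : ℕ) : ℂ) ^ (-(σ : ℂ)) with hw
  have hwsum : Summable w := by
    refine Summable.of_norm_bounded (g := fun p : Nat.Primes => ((p : ℕ) : ℝ) ^ (-σ))
      (Nat.Primes.summable_rpow.2 (by linarith)) fun p => ?_
    rw [hw, norm_mul, Complex.norm_natCast_cpow_of_pos p.prop.pos]
    simp only [Complex.neg_re, Complex.ofReal_re]
    exact mul_le_of_le_one_left (Real.rpow_nonneg (Nat.cast_nonneg _) _)
      (DirichletCharacter.norm_le_one χ _)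
  have hL : Complex.exp (∑' p : Nat.Primes, -Complex.log (1 - w p)) = χ.LFunction (σ : ℂ) := by
    rw [DirichletCharacter.LFunction_eq_LSeries χ hs]
    exact DirichletCharacter.LSeries_eulerProduct_exp_log χ hs
  have hlogsum : Summable fun p : Nat.Primes => -Complex.log (1 - w p) := hwsum.clog_one_sub.neg
  have hre_l : Summable fun p : Nat.Primes => (-Complex.log (1 - w p)).re :=
    Complex.reCLM.summable hlogsum
  have hterm : ∀ p : Nat.Primes, (-Complex.log (1 - w p)).re =
      -Real.log (1 - (χ ((p : ℕ) : ZMod q)).re * ((p : ℕ) : ℝ) ^ (-σ)) := fun p =>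
    (neg_log_re_eq χ hq p.prop hσ.le).1
  constructor
  · exact hre_l.congr hterm
  · rw [← hL, Complex.norm_exp, Real.log_exp, Complex.re_tsum hlogsum]
    exact tsum_congr hterm

/-! ### Letting `σ → 1+` -/

/-- For `σ > 1` and `X ≥ 1`: the tail of the logarithm of the Euler product is small,
`|log |L(σ, χ)| − ∑_{p ≤ X} −log(1 − Re χ(p) p^{−σ})| ≤ 2K'/log(X+1) + 4/(X+1)`. [folklore] -/
theorem abs_log_norm_sub_sum_le (hq : χ ^ 2 = 1) {K' : ℝ}
    (hK : ∀ x : ℕ, |∑ p ∈ Nat.primesLE x, (χ (p : ZMod q)).re * Real.log p / p| ≤ K')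
    {σ : ℝ} (hσ : 1 < σ) {X : ℕ} (hX : 1 ≤ X) :
    |Real.log ‖χ.LFunction (σ : ℂ)‖ -
        ∑ p ∈ Nat.primesLE X, -Real.log (1 - (χ (p : ZMod q)).re * (p : ℝ) ^ (-σ))| ≤
      2 * K' / Real.log (X + 1) + 4 / (X + 1) := by
  obtain ⟨hsum, hlog⟩ := log_norm_LFunction_eq_tsum χ hq hσ
  -- pass to an `ℕ`-indexed series with an indicator
  set G : ℕ → ℝ := fun n => if n.Prime then -Real.log (1 - (χ (n : ZMod q)).re * (n : ℝ) ^ (-σ)) else 0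
    with hG
  have hGind : G = Set.indicator {n : ℕ | n.Prime}
      (fun n => -Real.log (1 - (χ (n : ZMod q)).re * (n : ℝ) ^ (-σ))) := by
    funext n
    simp only [hG, Set.indicator, Set.mem_setOf_eq]
  have htsum : ∑' p : Nat.Primes, -Real.log (1 - (χ ((p : ℕ) : ZMod q)).re * ((p : ℕ) : ℝ) ^ (-σ)) =
      ∑' n : ℕ, G n := by
    rw [hGind]
    exact tsum_subtype {n : ℕ | n.Prime} (fun n => -Real.log (1 - (χ (n : ZMod q)).re * (n : ℝ) ^ (-σ)))
  have hGsum : Summable G := by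
    rw [hGind]
    exact (summable_subtype_iff_indicator.mp hsum)
  -- partial sums of `G` over `range (Y+1)` = sums over `primesLE Y`
  have hpartial : ∀ Y : ℕ, ∑ n ∈ Finset.range (Y + 1), G n =
      ∑ p ∈ Nat.primesLE Y, -Real.log (1 - (χ (p : ZMod q)).re * (p : ℝ) ^ (-σ)) := by
    intro Y
    rw [hG, ← Finset.sum_filter]
    rfl
  -- the window estimate for `Y ≥ X`
  have hwindow : ∀ Y : ℕ, X ≤ Y → |∑ n ∈ Finset.range (Y + 1), G n - ∑ n ∈ Finset.range (X + 1), G n| ≤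
      2 * K' / Real.log (X + 1) + 4 / (X + 1) := by
    intro Y hXY
    rw [hpartial, hpartial]
    have hsplit : ∑ p ∈ Nat.primesLE Y, -Real.log (1 - (χ (p : ZMod q)).re * (p : ℝ) ^ (-σ)) -
        ∑ p ∈ Nat.primesLE X, -Real.log (1 - (χ (p : ZMod q)).re * (p : ℝ) ^ (-σ)) =
        ∑ p ∈ (Nat.primesLE Y).filter (X < ·), -Real.log (1 - (χ (p : ZMod q)).re * (p : ℝ) ^ (-σ)) := by
      rw [sub_eq_iff_eq_add, ← Finset.sum_filter_add_sum_filter_not (Nat.primesLE Y) (X < ·)]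
      congr 1
      congr 1
      ext p
      simp only [Finset.mem_filter, Nat.mem_primesLE, not_lt]
      constructor
      · rintro ⟨⟨-, hp⟩, hpX⟩; exact ⟨hpX, hp⟩
      · rintro ⟨hpX, hp⟩; exact ⟨⟨hpX.trans hXY, hp⟩, hpX⟩
    rw [hsplit]
    -- split each term into `χ(p)p^{-σ}` and a second-order remainder
    have hdecomp : ∑ p ∈ (Nat.primesLE Y).filter (X < ·), -Real.log (1 - (χ (p : ZMod q)).re * (p : ℝ) ^ (-σ)) =
        ∑ p ∈ (Nat.primesLE Y).filter (X < ·), (χ (p : ZMod q)).re * (p : ℝ) ^ (-σ) +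
          ∑ p ∈ (Nat.primesLE Y).filter (X < ·),
            (-Real.log (1 - (χ (p : ZMod q)).re * (p : ℝ) ^ (-σ)) - (χ (p : ZMod q)).re * (p : ℝ) ^ (-σ)) := by
      rw [← Finset.sum_add_distrib]
      refine Finset.sum_congr rfl fun p _ => ?_; ring
    rw [hdecomp]
    have h1 := abs_window_sum_rpow_le χ hK hσ.le hX Y
    have h2 : |∑ p ∈ (Nat.primesLE Y).filter (X < ·),
        (-Real.log (1 - (χ (p : ZMod q)).re * (p : ℝ) ^ (-σ)) - (χ (p : ZMod q)).re * (p : ℝ) ^ (-σ))| ≤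
        4 / ((X : ℝ) + 1) := by
      refine (Finset.abs_sum_le_sum_abs _ _).trans ?_
      have hterm : ∀ p ∈ (Nat.primesLE Y).filter (X < ·),
          |(-Real.log (1 - (χ (p : ZMod q)).re * (p : ℝ) ^ (-σ)) - (χ (p : ZMod q)).re * (p : ℝ) ^ (-σ))| ≤
            2 * ((p : ℝ) ^ 2)⁻¹ := by
        intro p hp
        have hpp := Nat.prime_of_mem_primesLE (Finset.mem_filter.mp hp).1
        obtain ⟨-, hu⟩ := neg_log_re_eq χ hq hpp hσ.le
        refine (abs_neg_log_one_sub_sub_le hu).trans ?_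
        have hp2 : (2 : ℝ) ≤ p := by exact_mod_cast hpp.two_le
        have hp0 : (0 : ℝ) < p := by linarith
        have hr : (p : ℝ) ^ (-σ) ≤ (p : ℝ)⁻¹ := by
          calc (p : ℝ) ^ (-σ) ≤ (p : ℝ) ^ (-1 : ℝ) :=
                Real.rpow_le_rpow_of_exponent_le (by linarith) (by linarith)
            _ = (p : ℝ)⁻¹ := Real.rpow_neg_one _
        have hsq : ((χ (p : ZMod q)).re * (p : ℝ) ^ (-σ)) ^ 2 ≤ ((p : ℝ) ^ 2)⁻¹ := by
          have hb : |(χ (p : ZMod q)).re * (p : ℝ) ^ (-σ)| ≤ (p : ℝ)⁻¹ := by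
            rw [abs_mul, abs_of_nonneg (Real.rpow_nonneg hp0.le _)]
            calc |(χ (p : ZMod q)).re| * (p : ℝ) ^ (-σ) ≤ 1 * (p : ℝ) ^ (-σ) :=
                  mul_le_mul_of_nonneg_right ((Complex.abs_re_le_norm _).trans (χ.norm_le_one _))
                    (Real.rpow_nonneg hp0.le _)
              _ ≤ (p : ℝ)⁻¹ := by rw [one_mul]; exact hr
          calc ((χ (p : ZMod q)).re * (p : ℝ) ^ (-σ)) ^ 2 = |(χ (p : ZMod q)).re * (p : ℝ) ^ (-σ)| ^ 2 :=
                (sq_abs _).symm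
            _ ≤ ((p : ℝ)⁻¹) ^ 2 := pow_le_pow_left₀ (abs_nonneg _) hb 2
            _ = ((p : ℝ) ^ 2)⁻¹ := by rw [inv_pow]
        linarith
      refine (Finset.sum_le_sum hterm).trans ?_
      rw [← Finset.mul_sum]
      have hsub : (Nat.primesLE Y).filter (X < ·) ⊆ Finset.Ioo X (Y + 1) := by
        intro p hp
        simp only [Finset.mem_filter, Nat.mem_primesLE, Finset.mem_Ioo] at hp ⊢
        exact ⟨hp.2, Nat.lt_succ_of_le hp.1.1⟩
      calc 2 * ∑ p ∈ (Nat.primesLE Y).filter (X < ·), ((p : ℝ) ^ 2)⁻¹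
          ≤ 2 * ∑ n ∈ Finset.Ioo X (Y + 1), ((n : ℝ) ^ 2)⁻¹ :=
            mul_le_mul_of_nonneg_left
              (Finset.sum_le_sum_of_subset_of_nonneg hsub fun n _ _ => by positivity) (by norm_num)
        _ ≤ 2 * (2 / ((X : ℝ) + 1)) := by gcongr; exact sum_Ioo_inv_sq_le X (Y + 1)
        _ = 4 / ((X : ℝ) + 1) := by ring
    calc _ ≤ |∑ p ∈ (Nat.primesLE Y).filter (X < ·), (χ (p : ZMod q)).re * (p : ℝ) ^ (-σ)| +
          |∑ p ∈ (Nat.primesLE Y).filter (X < ·),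
            (-Real.log (1 - (χ (p : ZMod q)).re * (p : ℝ) ^ (-σ)) - (χ (p : ZMod q)).re * (p : ℝ) ^ (-σ))| :=
          abs_add_le _ _
      _ ≤ 2 * K' / Real.log (X + 1) + 4 / (X + 1) := add_le_add h1 h2
  -- pass to the limit `Y → ∞`
  have hlim : Tendsto (fun Y : ℕ => ∑ n ∈ Finset.range (Y + 1), G n) atTop (𝓝 (∑' n, G n)) :=
    (hGsum.hasSum.tendsto_sum_nat).comp (tendsto_add_atTop_nat 1)
  have hlim' : Tendsto (fun Y : ℕ => |∑ n ∈ Finset.range (Y + 1), G n - ∑ n ∈ Finset.range (X + 1), G n|)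
      atTop (𝓝 |∑' n, G n - ∑ n ∈ Finset.range (X + 1), G n|) :=
    (continuous_abs.tendsto _).comp (hlim.sub tendsto_const_nhds)
  have hle := le_of_tendsto hlim' (Filter.eventually_atTop.mpr ⟨X, hwindow⟩)
  rw [hlog, htsum, ← hpartial X]
  exact hle

/-- **The Euler product at `s = 1`, logarithmic form**: for a non-principal quadratic `χ` and
`X ≥ 1`, `|log L(1, χ) − ∑_{p ≤ X} −log(1 − χ(p)/p)| ≤ 2K'/log(X+1) + 4/(X+1)`
(let `σ → 1+` in `abs_log_norm_sub_sum_le`; `L(1, χ) > 0`). [folklore] -/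
theorem abs_log_sub_sum_le (hχ : χ ≠ 1) (hq : χ ^ 2 = 1) {K' : ℝ}
    (hK : ∀ x : ℕ, |∑ p ∈ Nat.primesLE x, (χ (p : ZMod q)).re * Real.log p / p| ≤ K')
    {X : ℕ} (hX : 1 ≤ X) :
    |Real.log ‖χ.LFunction 1‖ -
        ∑ p ∈ Nat.primesLE X, -Real.log (1 - (χ (p : ZMod q)).re / p)| ≤
      2 * K' / Real.log (X + 1) + 4 / (X + 1) := by
  -- the two sides as functions of `σ`
  set f : ℝ → ℝ := fun σ => Real.log ‖χ.LFunction (σ : ℂ)‖ with hf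
  set g : ℝ → ℝ := fun σ => ∑ p ∈ Nat.primesLE X, -Real.log (1 - (χ (p : ZMod q)).re * (p : ℝ) ^ (-σ))
    with hg
  have hL1 : χ.LFunction 1 ≠ 0 :=
    DirichletCharacter.LFunction_ne_zero_of_one_le_re χ (Or.inl hχ) (by simp)
  -- continuity at `σ = 1`
  have hfc : ContinuousAt f 1 := by
    have h1 : ContinuousAt (fun σ : ℝ => χ.LFunction (σ : ℂ)) 1 :=
      ((DirichletCharacter.differentiable_LFunction hχ).continuous.comp continuous_ofReal).continuousAt
    have h2 : ContinuousAt (fun σ : ℝ => ‖χ.LFunction (σ : ℂ)‖) 1 := h1.norm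
    exact h2.log (by simpa using hL1)
  have hgc : ContinuousAt g 1 := by
    refine tendsto_finsetSum _ fun p hp => ?_
    have hpp := Nat.prime_of_mem_primesLE hp
    have hp0 : (0 : ℝ) < p := by exact_mod_cast hpp.pos
    have hr : ContinuousAt (fun σ : ℝ => (p : ℝ) ^ (-σ)) 1 :=
      (Real.continuousAt_const_rpow hp0.ne').comp continuous_neg.continuousAt
    have hu : ContinuousAt (fun σ : ℝ => 1 - (χ (p : ZMod q)).re * (p : ℝ) ^ (-σ)) 1 :=
      continuousAt_const.sub (continuousAt_const.mul hr)
    have hpos : 1 - (χ (p : ZMod q)).re * (p : ℝ) ^ (-(1 : ℝ)) ≠ 0 := by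
      obtain ⟨-, hb⟩ := neg_log_re_eq χ hq hpp le_rfl
      have := (abs_le.mp hb).2; linarith
    exact (hu.log hpos).neg
  -- the inequality for `σ > 1`, and the limit
  have hev : ∀ᶠ σ in 𝓝[>] (1 : ℝ), |f σ - g σ| ≤ 2 * K' / Real.log (X + 1) + 4 / (X + 1) := by
    filter_upwards [self_mem_nhdsWithin] with σ hσ
    exact abs_log_norm_sub_sum_le χ hq hK hσ hX
  have hlim : Tendsto (fun σ => |f σ - g σ|) (𝓝[>] (1 : ℝ)) (𝓝 |f 1 - g 1|) :=
    ((continuous_abs.tendsto _).comp ((hfc.sub hgc).tendsto)).mono_left nhdsWithin_le_nhds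
  have hle := le_of_tendsto hlim hev
  have hg1 : g 1 = ∑ p ∈ Nat.primesLE X, -Real.log (1 - (χ (p : ZMod q)).re / p) := by
    simp only [hg]
    refine Finset.sum_congr rfl fun p _ => ?_
    rw [Real.rpow_neg_one, div_eq_mul_inv]
  have hf1 : f 1 = Real.log ‖χ.LFunction 1‖ := by simp [hf]
  rw [← hf1, ← hg1]
  exact hle

/-! ### The Euler product at `s = 1` -/

/-- **`∏_{p ≤ X} (1 − χ(p)/p) → 1/L(1, χ)`** for a non-principal quadratic character `χ`
(`L(1, χ) > 0` real). [cite: MontgomeryVaughan2007, §4.3] -/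
theorem tendsto_prod_one_sub_div (hχ : χ ≠ 1) (hq : χ ^ 2 = 1) :
    Tendsto (fun X : ℕ => ∏ p ∈ Nat.primesLE X, (1 - (χ (p : ZMod q)).re / p)) atTop
      (𝓝 ((χ.LFunction 1).re)⁻¹) := by
  obtain ⟨K', hK⟩ := CharacterMertens.exists_abs_sum_primesLE_re_mul_log_div_le χ hχ hq
  -- `L(1, χ)` is real and positive
  have hL1pos : 0 < (χ.LFunction 1).re := by
    have h := ZetaMul.LOne_pos χ hχ hq
    rwa [ZetaMul.LOne] at h
  have hL1im : (χ.LFunction 1).im = 0 := by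
    have := DirichletAbel.LFunction_ofReal_im_eq_zero χ hχ hq (σ := 1) one_pos
    simpa using this
  have hnorm : ‖χ.LFunction 1‖ = (χ.LFunction 1).re := by
    rw [← Complex.re_add_im (χ.LFunction 1), hL1im]
    simp [abs_of_pos hL1pos]
  -- each factor is positive, so the product is `exp(−E(X))`
  have hfac : ∀ p : ℕ, p.Prime → 0 < 1 - (χ (p : ZMod q)).re / p := by
    intro p hp
    obtain ⟨-, hb⟩ := neg_log_re_eq χ hq hp le_rfl
    rw [Real.rpow_neg_one] at hb
    have := (abs_le.mp hb).2
    rw [div_eq_mul_inv]; linarith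
  have hprod : ∀ X : ℕ, ∏ p ∈ Nat.primesLE X, (1 - (χ (p : ZMod q)).re / p) =
      Real.exp (-(∑ p ∈ Nat.primesLE X, -Real.log (1 - (χ (p : ZMod q)).re / p))) := by
    intro X
    rw [Finset.sum_neg_distrib, neg_neg, Real.exp_sum]
    refine Finset.prod_congr rfl fun p hp => ?_
    rw [Real.exp_log (hfac p (Nat.prime_of_mem_primesLE hp))]
  simp_rw [hprod]
  -- `E(X) → log L(1, χ)`
  have hE : Tendsto (fun X : ℕ => ∑ p ∈ Nat.primesLE X, -Real.log (1 - (χ (p : ZMod q)).re / p)) atTop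
      (𝓝 (Real.log ((χ.LFunction 1).re))) := by
    rw [← hnorm]
    have hbound : Tendsto (fun X : ℕ => 2 * K' / Real.log ((X : ℝ) + 1) + 4 / ((X : ℝ) + 1)) atTop (𝓝 0) := by
      have h1 : Tendsto (fun X : ℕ => (X : ℝ) + 1) atTop atTop :=
        tendsto_atTop_add_const_right _ 1 tendsto_natCast_atTop_atTop
      have h2 : Tendsto (fun X : ℕ => Real.log ((X : ℝ) + 1)) atTop atTop := Real.tendsto_log_atTop.comp h1
      have h3 := (h2.inv_tendsto_atTop).const_mul (2 * K')
      have h4 := (h1.inv_tendsto_atTop).const_mul 4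
      simp only [mul_zero] at h3 h4
      have := h3.add h4
      rw [zero_add] at this
      refine this.congr fun X => ?_
      simp only [Pi.inv_apply]; ring
    refine tendsto_sub_nhds_zero_iff.mp ?_
    rw [show (fun X : ℕ => ∑ p ∈ Nat.primesLE X, -Real.log (1 - (χ (p : ZMod q)).re / p) -
        Real.log ‖χ.LFunction 1‖) = fun X : ℕ => -(Real.log ‖χ.LFunction 1‖ -
          ∑ p ∈ Nat.primesLE X, -Real.log (1 - (χ (p : ZMod q)).re / p)) by funext X; ring]
    rw [← neg_zero]
    refine Tendsto.neg ?_
    refine squeeze_zero_norm' ?_ hbound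
    filter_upwards [Filter.eventually_ge_atTop 1] with X hX
    rw [Real.norm_eq_abs]
    exact abs_log_sub_sum_le χ hχ hq hK hX
  have := (Real.continuous_exp.tendsto _).comp hE.neg
  rwa [Function.comp_def, Real.exp_neg, Real.exp_log hL1pos] at this

end Literature.NumberTheory.LFunctions.EulerProductOne
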